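import Mathlib
import HarnessLib

/-!
# Taylor coefficients of a rational function `P/Q` (`Q(0) = 1`): the division recursion, a geometric
# majorant from a denominator margin, and convergence to `P/Q`

Topic `Literature/Analysis/ODE` (namespace `Literature.Analysis.ODE`). The elementary supply line for the Frobenius
files of this directory (`RegularSingularAnalyticBranch*.lean`, `RegularSingularScalarBranch.lean`,
`RegularSingularLogBranch*.lean`): those theorems take ANALYTIC coefficient data in the quantitative shape
«`p(x) = Σ pₖ xᵏ` on a disc, `‖pₖ‖ ≤ K aᵏ`». In the applications the coefficients of the ODE are RATIONAL functions
(e.g. the marginal tearing-mode equation `x y″ + (x/(x + r_s)) y′ + q(x) y = 0` at a rational surface, with `q`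
rational in `x`), and the data must come from exact arithmetic on two polynomials. Over `𝕜 = ℝ` or `ℂ`:

* `ratTaylorCoeff P Q n` — the Taylor coefficients `cₙ` of `P/Q` at `0` for `Q(0) = 1`, by the division recursion
  `cₙ = Pₙ − Σ_{k<n} Q_{n−k} c_k` [cite: Henrici1974, §1.2 eq. (1.2-2)] (computable by `norm_num` from the
  coefficients; `sum_ratTaylorCoeff_eq_coeff`: `Σ_{k≤n} Q_{n−k} c_k = Pₙ`);
* `norm_ratTaylorCoeff_le` — THE MAJORANT: if for some `ρ > 0` the DENOMINATOR MARGIN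
  `Σ_{j≥1} ‖Q_j‖ ρʲ ≤ θ < 1` holds and `Σ_i ‖P_i‖ ρⁱ ≤ S`, then `‖cₙ‖ ≤ (S/(1 − θ)) ρ⁻ⁿ` (Cauchy's induction on the
  recursion, as in Henrici's proof that the reciprocal of a convergent series converges
  [cite: Henrici1974, §2.3 Lemma 2.3f]); both hypotheses are finite sums of absolute values — decidable on rationals;
* `eval_ne_zero_of_margin`, `hasSum_ratTaylorCoeff` — on `‖x‖ < ρ`: `Q(x) ≠ 0` and `Σ xⁿ cₙ = P(x)/Q(x)`
  (absolute convergence + Cauchy product with `Q` + the coefficient identity).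

So `(pc := ratTaylorCoeff P Q, a := ρ⁻¹, K := S/(1 − θ), ρ₀ := ρ)` is admissible input for `IsFrobeniusData` /
`IsScalarLogData`, with nothing but polynomial arithmetic to check.

## References
* P. Henrici, *Applied and Computational Complex Analysis*, Vol. 1, Wiley 1974: §1.2 (units of the ring of formal
  power series, recurrence (1.2-2)), §2.3 Lemma 2.3f (radius of convergence of the reciprocal series by a majorant
  induction, (2.3-6)–(2.3-8)). Key `Henrici1974`.
-/

noncomputable section

open Finset Filter Metric Polynomial
open scoped Topology

namespace Literature.Analysis.ODE

variable {𝕜 : Type*} [RCLike 𝕜]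

/-- **Taylor coefficients of `P/Q` at `0`** for polynomials `P`, `Q` with `Q(0) = 1`, by the division recursion
`cₙ = Pₙ − Σ_{k<n} Q_{n−k} c_k`. [cite: Henrici1974, §1.3] -/
def ratTaylorCoeff (P Q : 𝕜[X]) (n : ℕ) : 𝕜 :=
  P.coeff n - ∑ k : Fin n, Q.coeff (n - k) * ratTaylorCoeff P Q k

/-- The recursion with a `Finset.range` sum: `cₙ = Pₙ − Σ_{k<n} Q_{n−k} c_k`. [cite: Henrici1974, §1.2 eq. (1.2-2)] -/
theorem ratTaylorCoeff_eq (P Q : 𝕜[X]) (n : ℕ) :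
    ratTaylorCoeff P Q n = P.coeff n - ∑ k ∈ range n, Q.coeff (n - k) * ratTaylorCoeff P Q k := by
  rw [ratTaylorCoeff, Finset.sum_range]

/-- THE COEFFICIENT IDENTITY `Σ_{k ≤ n} Q_{n−k} c_k = Pₙ` (i.e. `Q · C = P` as formal power series) when
`Q₀ = 1`. [cite: Henrici1974, §1.3] -/
theorem sum_ratTaylorCoeff_eq_coeff (P Q : 𝕜[X]) (hQ : Q.coeff 0 = 1) (n : ℕ) :
    ∑ k ∈ range (n + 1), Q.coeff (n - k) * ratTaylorCoeff P Q k = P.coeff n := by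
  rw [Finset.sum_range_succ, Nat.sub_self, hQ, one_mul, ratTaylorCoeff_eq]
  ring

/-! ### The geometric majorant from a denominator margin -/

section Majorant

variable (P Q : 𝕜[X]) {ρ θ S : ℝ}

/-- Partial sums of the denominator tail `Σ_{j<N} ‖Q_{j+1}‖ ρ^{j+1}` never exceed the full one (terms beyond the
degree vanish). [folklore] -/
private theorem sum_range_denTail_le (hρ : 0 ≤ ρ)
    (hθ : ∑ j ∈ range Q.natDegree, ‖Q.coeff (j + 1)‖ * ρ ^ (j + 1) ≤ θ) (N : ℕ) :
    ∑ j ∈ range N, ‖Q.coeff (j + 1)‖ * ρ ^ (j + 1) ≤ θ := by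
  rcases le_or_gt N Q.natDegree with hN | hN
  · exact (Finset.sum_le_sum_of_subset_of_nonneg (Finset.range_mono hN)
      (fun j _ _ => by positivity)).trans hθ
  · have h0 : ∀ j ∈ range N, j ∉ range Q.natDegree → ‖Q.coeff (j + 1)‖ * ρ ^ (j + 1) = 0 := by
      intro j _ hj'
      rw [Finset.mem_range, not_lt] at hj'
      rw [Polynomial.coeff_eq_zero_of_natDegree_lt (by omega), norm_zero, zero_mul]
    rwa [Finset.sum_subset (Finset.range_mono hN.le) h0] at hθ

/-- A single numerator term never exceeds `S = Σ_i ‖P_i‖ ρ^i`. [folklore] -/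
private theorem norm_coeff_mul_pow_le (hρ : 0 ≤ ρ)
    (hS : ∑ i ∈ range (P.natDegree + 1), ‖P.coeff i‖ * ρ ^ i ≤ S) (n : ℕ) :
    ‖P.coeff n‖ * ρ ^ n ≤ S := by
  rcases le_or_gt n P.natDegree with hn | hn
  · refine le_trans ?_ hS
    exact Finset.single_le_sum (f := fun i => ‖P.coeff i‖ * ρ ^ i) (fun i _ => by positivity)
      (Finset.mem_range.2 (by omega))
  · rw [Polynomial.coeff_eq_zero_of_natDegree_lt hn, norm_zero, zero_mul]
    exact le_trans (by positivity : (0 : ℝ) ≤ ∑ i ∈ range (P.natDegree + 1), ‖P.coeff i‖ * ρ ^ i) hS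

/-- **THE MAJORANT (Cauchy / Henrici).** Suppose, for some `ρ > 0`, the
DENOMINATOR MARGIN `Σ_{j ≥ 1} ‖Q_j‖ ρʲ ≤ θ < 1` and `Σ_i ‖P_i‖ ρⁱ ≤ S`. Then the division coefficients obey
`‖cₙ‖ ≤ (S/(1 − θ)) ρ⁻ⁿ` for all `n` — induction on the recursion, as in Henrici's proof that the reciprocal of a
convergent series converges. [cite: Henrici1974, §1.2 eq. (1.2-2); §2.3 Lemma 2.3f, eq. (2.3-8)] -/
theorem norm_ratTaylorCoeff_le (hρ : 0 < ρ)
    (hθ : ∑ j ∈ range Q.natDegree, ‖Q.coeff (j + 1)‖ * ρ ^ (j + 1) ≤ θ) (hθ1 : θ < 1)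
    (hS : ∑ i ∈ range (P.natDegree + 1), ‖P.coeff i‖ * ρ ^ i ≤ S) (n : ℕ) :
    ‖ratTaylorCoeff P Q n‖ ≤ S / (1 - θ) * ρ⁻¹ ^ n := by
  have hθ0 : 0 ≤ θ := le_trans (Finset.sum_nonneg fun j _ => by positivity) hθ
  have hS0 : 0 ≤ S := le_trans (Finset.sum_nonneg fun j _ => by positivity) hS
  have h1θ : 0 < 1 - θ := by linarith
  -- the claim `‖cₙ‖ ρⁿ ≤ S/(1 − θ)` by strong induction
  suffices H : ∀ n, ‖ratTaylorCoeff P Q n‖ * ρ ^ n ≤ S / (1 - θ) by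
    have h := H n
    rw [inv_pow, ← div_eq_mul_inv, le_div_iff₀ (pow_pos hρ n)]
    exact h
  intro n
  induction n using Nat.strong_induction_on with | _ n ih => ?_
  -- the denominator sum `Σ_{k<n} ‖Q_{n−k}‖ ρ^{n−k} (‖c_k‖ ρ^k) ≤ θ · S/(1−θ)`
  have hden : ∑ k ∈ range n, ‖Q.coeff (n - k)‖ * ρ ^ (n - k) * (‖ratTaylorCoeff P Q k‖ * ρ ^ k)
      ≤ θ * (S / (1 - θ)) := by
    calc ∑ k ∈ range n, ‖Q.coeff (n - k)‖ * ρ ^ (n - k) * (‖ratTaylorCoeff P Q k‖ * ρ ^ k)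
        ≤ ∑ k ∈ range n, ‖Q.coeff (n - k)‖ * ρ ^ (n - k) * (S / (1 - θ)) :=
          Finset.sum_le_sum fun k hk => mul_le_mul_of_nonneg_left (ih k (mem_range.1 hk)) (by positivity)
      _ = (∑ k ∈ range n, ‖Q.coeff (n - k)‖ * ρ ^ (n - k)) * (S / (1 - θ)) := by rw [Finset.sum_mul]
      _ = (∑ j ∈ range n, ‖Q.coeff (j + 1)‖ * ρ ^ (j + 1)) * (S / (1 - θ)) := by
          congr 1
          rw [← Finset.sum_range_reflect (fun j => ‖Q.coeff (j + 1)‖ * ρ ^ (j + 1)) n]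
          refine Finset.sum_congr rfl fun k hk => ?_
          have hk := mem_range.1 hk
          rw [show n - 1 - k + 1 = n - k by omega]
      _ ≤ θ * (S / (1 - θ)) :=
          mul_le_mul_of_nonneg_right (sum_range_denTail_le Q hρ.le hθ n) (by positivity)
  calc ‖ratTaylorCoeff P Q n‖ * ρ ^ n
      = ‖P.coeff n - ∑ k ∈ range n, Q.coeff (n - k) * ratTaylorCoeff P Q k‖ * ρ ^ n := by
        rw [ratTaylorCoeff_eq]
    _ ≤ (‖P.coeff n‖ + ∑ k ∈ range n, ‖Q.coeff (n - k)‖ * ‖ratTaylorCoeff P Q k‖) * ρ ^ n := by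
        refine mul_le_mul_of_nonneg_right ((norm_sub_le _ _).trans (add_le_add le_rfl ?_)) (by positivity)
        exact (norm_sum_le _ _).trans (Finset.sum_le_sum fun k _ => norm_mul_le _ _)
    _ = ‖P.coeff n‖ * ρ ^ n
        + ∑ k ∈ range n, ‖Q.coeff (n - k)‖ * ρ ^ (n - k) * (‖ratTaylorCoeff P Q k‖ * ρ ^ k) := by
        rw [add_mul, Finset.sum_mul]
        congr 1
        refine Finset.sum_congr rfl fun k hk => ?_
        have hk := mem_range.1 hk
        rw [show ρ ^ n = ρ ^ (n - k) * ρ ^ k by rw [← pow_add]; congr 1; omega]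
        ring
    _ ≤ S + θ * (S / (1 - θ)) := add_le_add (norm_coeff_mul_pow_le P hρ.le hS n) hden
    _ = S / (1 - θ) := by field_simp; ring

end Majorant

/-! ### Convergence to `P/Q` on the disc `‖x‖ < ρ` -/

section Convergence

variable (P Q : 𝕜[X]) {ρ θ S : ℝ}

/-- The denominator stays within `θ` of `1` on the disc: `‖Q(x) − 1‖ ≤ Σ_{j≥1} ‖Q_j‖ ρʲ ≤ θ` for `‖x‖ < ρ`
(`Q₀ = 1`). [cite: Henrici1974, §2.3 Lemma 2.3f] -/
theorem norm_eval_sub_one_le (hQ : Q.coeff 0 = 1)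
    (hθ : ∑ j ∈ range Q.natDegree, ‖Q.coeff (j + 1)‖ * ρ ^ (j + 1) ≤ θ) {x : 𝕜} (hx : ‖x‖ < ρ) :
    ‖Q.eval x - 1‖ ≤ θ := by
  rw [Polynomial.eval_eq_sum_range, Finset.sum_range_succ', pow_zero, mul_one, hQ, add_sub_cancel_right]
  calc ‖∑ j ∈ range Q.natDegree, Q.coeff (j + 1) * x ^ (j + 1)‖
      ≤ ∑ j ∈ range Q.natDegree, ‖Q.coeff (j + 1)‖ * ρ ^ (j + 1) := by
        refine (norm_sum_le _ _).trans (Finset.sum_le_sum fun j _ => ?_)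
        rw [norm_mul, norm_pow]
        exact mul_le_mul_of_nonneg_left (pow_le_pow_left₀ (norm_nonneg _) hx.le _) (norm_nonneg _)
    _ ≤ θ := hθ

/-- Hence `Q(x) ≠ 0` (indeed `‖Q(x)‖ ≥ 1 − θ > 0`) on the disc when `θ < 1`. [cite: Henrici1974, §2.3 Lemma 2.3f] -/
theorem eval_ne_zero_of_margin (hQ : Q.coeff 0 = 1)
    (hθ : ∑ j ∈ range Q.natDegree, ‖Q.coeff (j + 1)‖ * ρ ^ (j + 1) ≤ θ) (hθ1 : θ < 1) {x : 𝕜}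
    (hx : ‖x‖ < ρ) : Q.eval x ≠ 0 := by
  intro h0
  have h := norm_eval_sub_one_le Q hQ hθ hx
  rw [h0, zero_sub, norm_neg, norm_one] at h
  linarith

/-- **CONVERGENCE AND IDENTIFICATION.** Under the denominator margin `Σ_{j≥1} ‖Q_j‖ ρʲ ≤ θ < 1` (`Q₀ = 1`) and
`Σ_i ‖P_i‖ ρⁱ ≤ S`: for every `‖x‖ < ρ`, `Q(x) ≠ 0` and `Σ xⁿ cₙ = P(x)/Q(x)` (absolutely convergent; Cauchy product
with `Q` and the coefficient identity `Σ_{k≤n} Q_{n−k} c_k = Pₙ`). Together with `norm_ratTaylorCoeff_le` this is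
exactly the shape `‖cₙ‖ ≤ K aⁿ`, `HasSum (xⁿ cₙ) (f x)` in which the Frobenius files (`IsFrobeniusData`,
`IsScalarLogData`) take analytic coefficient data — so RATIONAL coefficient functions of an ODE enter those theorems
by exact arithmetic on `P`, `Q` alone. [cite: Henrici1974, §1.2 eq. (1.2-2); §2.3 Lemma 2.3f] -/
theorem hasSum_ratTaylorCoeff (hQ : Q.coeff 0 = 1) (hρ : 0 < ρ)
    (hθ : ∑ j ∈ range Q.natDegree, ‖Q.coeff (j + 1)‖ * ρ ^ (j + 1) ≤ θ) (hθ1 : θ < 1)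
    (hS : ∑ i ∈ range (P.natDegree + 1), ‖P.coeff i‖ * ρ ^ i ≤ S) {x : 𝕜} (hx : ‖x‖ < ρ) :
    Q.eval x ≠ 0 ∧ HasSum (fun n => x ^ n * ratTaylorCoeff P Q n) (P.eval x / Q.eval x) := by
  have hQx : Q.eval x ≠ 0 := eval_ne_zero_of_margin Q hQ hθ hθ1 hx
  refine ⟨hQx, ?_⟩
  set c : ℕ → 𝕜 := ratTaylorCoeff P Q with hc_def
  have hθ0 : 0 ≤ θ := le_trans (Finset.sum_nonneg fun j _ => by positivity) hθ
  -- absolute convergence of `Σ xⁿ cₙ` (geometric majorant, ratio `‖x‖/ρ < 1`)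
  have hr0 : 0 ≤ ‖x‖ * ρ⁻¹ := by positivity
  have hr1 : ‖x‖ * ρ⁻¹ < 1 := by rw [← div_eq_mul_inv, div_lt_one hρ]; exact hx
  have hcs : Summable fun n => ‖x ^ n * c n‖ := by
    refine .of_nonneg_of_le (fun _ => norm_nonneg _) (fun n => ?_)
      ((summable_geometric_of_lt_one hr0 hr1).mul_left (S / (1 - θ)))
    rw [norm_mul, norm_pow, mul_pow]
    calc ‖x‖ ^ n * ‖c n‖ ≤ ‖x‖ ^ n * (S / (1 - θ) * ρ⁻¹ ^ n) :=
          mul_le_mul_of_nonneg_left (norm_ratTaylorCoeff_le P Q hρ hθ hθ1 hS n) (by positivity)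
      _ = S / (1 - θ) * (‖x‖ ^ n * ρ⁻¹ ^ n) := by ring
  -- `Q` as a finitely supported series
  set qf : ℕ → 𝕜 := fun n => x ^ n * Q.coeff n with hqf_def
  have hq_zero : ∀ n ∉ range (Q.natDegree + 1), qf n = 0 := by
    intro n hn
    rw [Finset.mem_range, not_lt] at hn
    rw [hqf_def]
    simp only
    rw [Polynomial.coeff_eq_zero_of_natDegree_lt (by omega), mul_zero]
  have hq_eval : ∑ n ∈ range (Q.natDegree + 1), qf n = Q.eval x := by
    rw [Polynomial.eval_eq_sum_range]
    exact Finset.sum_congr rfl fun n _ => mul_comm _ _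
  have hqsum : HasSum qf (Q.eval x) := hq_eval ▸ hasSum_sum_of_ne_finset_zero hq_zero
  have hqs_norm : Summable fun n => ‖qf n‖ :=
    summable_of_ne_finset_zero (s := range (Q.natDegree + 1)) fun n hn => by rw [hq_zero n hn, norm_zero]
  -- `P` likewise
  set pf : ℕ → 𝕜 := fun n => x ^ n * P.coeff n with hpf_def
  have hp_zero : ∀ n ∉ range (P.natDegree + 1), pf n = 0 := by
    intro n hn
    rw [Finset.mem_range, not_lt] at hn
    rw [hpf_def]
    simp only
    rw [Polynomial.coeff_eq_zero_of_natDegree_lt (by omega), mul_zero]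
  have hp_eval : ∑ n ∈ range (P.natDegree + 1), pf n = P.eval x := by
    rw [Polynomial.eval_eq_sum_range]
    exact Finset.sum_congr rfl fun n _ => mul_comm _ _
  have hpsum : HasSum pf (P.eval x) := hp_eval ▸ hasSum_sum_of_ne_finset_zero hp_zero
  -- the Cauchy product `Q(x) · Σ xⁿ cₙ = Σ xⁿ Pₙ = P(x)`
  have hanti : ∀ n, ∑ kl ∈ antidiagonal n, qf kl.1 * (x ^ kl.2 * c kl.2) = pf n := by
    intro n
    have h1 : ∑ kl ∈ antidiagonal n, qf kl.1 * (x ^ kl.2 * c kl.2) =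
        x ^ n * ∑ kl ∈ antidiagonal n, Q.coeff kl.1 * c kl.2 := by
      rw [Finset.mul_sum]
      refine Finset.sum_congr rfl fun kl hkl => ?_
      rw [HasAntidiagonal.mem_antidiagonal] at hkl
      rw [hqf_def]
      simp only
      rw [← hkl, pow_add]
      ring
    rw [h1, hpf_def]
    simp only
    congr 1
    rw [← Nat.sum_antidiagonal_swap]
    simp only [Prod.fst_swap, Prod.snd_swap]
    rw [Nat.sum_antidiagonal_eq_sum_range_succ (fun i j => Q.coeff j * c i)]
    exact sum_ratTaylorCoeff_eq_coeff P Q hQ n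
  have hprod := tsum_mul_tsum_eq_tsum_sum_antidiagonal_of_summable_norm hqs_norm hcs
  rw [hqsum.tsum_eq, tsum_congr hanti, hpsum.tsum_eq] at hprod
  -- conclude
  have hval : ∑' n, x ^ n * c n = P.eval x / Q.eval x := by
    rw [eq_div_iff hQx, mul_comm, hprod]
  exact hval ▸ hcs.of_norm.hasSum

/-! ### Degree-bound forms (what a concrete instance checks) -/

/-- The denominator margin may be summed up to ANY `D ≥ deg Q` (extra terms vanish; in a concrete instance `deg Q ≤ D`
comes from `compute_degree` / `natDegree_le_iff_coeff_eq_zero`). [cite: Henrici1974, §2.3 Lemma 2.3f] -/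
theorem denMargin_of_natDegree_le {D : ℕ} (hD : Q.natDegree ≤ D) (hρ : 0 ≤ ρ)
    (hθ : ∑ j ∈ range D, ‖Q.coeff (j + 1)‖ * ρ ^ (j + 1) ≤ θ) :
    ∑ j ∈ range Q.natDegree, ‖Q.coeff (j + 1)‖ * ρ ^ (j + 1) ≤ θ :=
  (Finset.sum_le_sum_of_subset_of_nonneg (Finset.range_mono hD) (fun j _ _ => by positivity)).trans hθ

/-- The numerator sum may be taken up to ANY `D ≥ deg P`. [cite: Henrici1974, §2.3 Lemma 2.3f] -/
theorem numSum_of_natDegree_le {D : ℕ} (hD : P.natDegree ≤ D) (hρ : 0 ≤ ρ)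
    (hS : ∑ i ∈ range (D + 1), ‖P.coeff i‖ * ρ ^ i ≤ S) :
    ∑ i ∈ range (P.natDegree + 1), ‖P.coeff i‖ * ρ ^ i ≤ S :=
  (Finset.sum_le_sum_of_subset_of_nonneg (Finset.range_mono (by omega)) (fun j _ _ => by positivity)).trans hS

/-- **MAJORANT + CONVERGENCE, degree-bound form.** With `deg Q ≤ D_Q`, `deg P ≤ D_P`, `Q₀ = 1`, `ρ > 0`,
`Σ_{j<D_Q} ‖Q_{j+1}‖ ρ^{j+1} ≤ θ < 1` and `Σ_{i≤D_P} ‖P_i‖ ρⁱ ≤ S` — four facts about finitely many coefficients —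
the Taylor coefficients of `P/Q` satisfy `‖cₙ‖ ≤ (S/(1 − θ)) ρ⁻ⁿ`, and on `‖x‖ < ρ`: `Q(x) ≠ 0` and
`Σ xⁿ cₙ = P(x)/Q(x)`. [cite: Henrici1974, §1.2 eq. (1.2-2); §2.3 Lemma 2.3f] -/
theorem ratTaylor_of_natDegree_le (hQ : Q.coeff 0 = 1) (hρ : 0 < ρ) {DQ DP : ℕ} (hDQ : Q.natDegree ≤ DQ)
    (hDP : P.natDegree ≤ DP) (hθ : ∑ j ∈ range DQ, ‖Q.coeff (j + 1)‖ * ρ ^ (j + 1) ≤ θ) (hθ1 : θ < 1)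
    (hS : ∑ i ∈ range (DP + 1), ‖P.coeff i‖ * ρ ^ i ≤ S) :
    (∀ n, ‖ratTaylorCoeff P Q n‖ ≤ S / (1 - θ) * ρ⁻¹ ^ n) ∧
      ∀ x : 𝕜, ‖x‖ < ρ → Q.eval x ≠ 0 ∧ HasSum (fun n => x ^ n * ratTaylorCoeff P Q n) (P.eval x / Q.eval x) :=
  have hθ' := denMargin_of_natDegree_le Q hDQ hρ.le hθ
  have hS' := numSum_of_natDegree_le P hDP hρ.le hS
  ⟨norm_ratTaylorCoeff_le P Q hρ hθ' hθ1 hS', fun _ hx => hasSum_ratTaylorCoeff P Q hQ hρ hθ' hθ1 hS' hx⟩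

end Convergence

/-! ### Preconditioned margins: the coefficients of `P/Q` are those of `(P·U)/(Q·U)` -/

section Precondition

variable (P Q : 𝕜[X])

/-- The coefficient identity in power-series form: for ANY sequence `c`, the `n`-th coefficient of `Q · (Σ cₖ Xᵏ)` is
`Σ_{k ≤ n} Q_{n−k} c_k`. [cite: Henrici1974, §1.2 eq. (1.2-2)] -/
theorem coeff_coe_mul_mk (c : ℕ → 𝕜) (n : ℕ) :
    PowerSeries.coeff n ((Q : PowerSeries 𝕜) * PowerSeries.mk c) = ∑ k ∈ range (n + 1), Q.coeff (n - k) * c k := by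
  rw [PowerSeries.coeff_mul, Finset.Nat.sum_antidiagonal_eq_sum_range_succ_mk]
  simp only [Polynomial.coeff_coe, PowerSeries.coeff_mk]
  rw [← Finset.sum_range_reflect (fun k => Q.coeff (n - k) * c k) (n + 1)]
  refine Finset.sum_congr rfl fun k hk => ?_
  have hk := Finset.mem_range.1 hk
  congr 2
  omega

/-- UNIQUENESS of the division recursion: if `Q₀ = 1` and a sequence `c` satisfies `Σ_{k ≤ n} Q_{n−k} c_k = Pₙ` for
every `n` (i.e. `Q · C = P` as formal power series), then `c` is THE sequence `ratTaylorCoeff P Q` (the quotient in the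
ring of formal power series is unique because `Q` is a unit). [cite: Henrici1974, §1.2 Thm 1.2b] -/
theorem ratTaylorCoeff_unique (hQ : Q.coeff 0 = 1) {c : ℕ → 𝕜}
    (hc : ∀ n, ∑ k ∈ range (n + 1), Q.coeff (n - k) * c k = P.coeff n) (n : ℕ) :
    c n = ratTaylorCoeff P Q n := by
  induction n using Nat.strong_induction_on with | _ n ih => ?_
  have h := hc n
  rw [Finset.sum_range_succ, Nat.sub_self, hQ, one_mul] at h
  have hS : ∑ k ∈ range n, Q.coeff (n - k) * c k = ∑ k ∈ range n, Q.coeff (n - k) * ratTaylorCoeff P Q k :=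
    Finset.sum_congr rfl fun k hk => by rw [ih k (Finset.mem_range.1 hk)]
  rw [ratTaylorCoeff_eq, ← h, hS]
  ring

/-- **PRECONDITIONING.** For any polynomial `U` with `U₀ = 1` — in practice `U = Q⁻¹ mod X^{d+1}`, so that
`Q·U = 1 + O(X^{d+1})` has a small margin `Σ_{j≥1} ‖(QU)_j‖ ρʲ` up to `ρ` near the true radius of `1/Q` — the division
coefficients of `(P·U)/(Q·U)` are those of `P/Q`. Hence the geometric majorant `norm_ratTaylorCoeff_le` applied to the
pair `(P·U, Q·U)` bounds `ratTaylorCoeff P Q` itself, with a rate `ρ⁻¹` close to optimal: the certified counterpart of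
choosing the radius `τ_k < ρ(z_{k−1})` in Cauchy's coefficient estimate. [cite: Henrici1974, §1.2 Thm 1.2b; §3.6 eq. (3.6-10)] -/
theorem ratTaylorCoeff_mul_right (hQ : Q.coeff 0 = 1) {U : 𝕜[X]} (hU : U.coeff 0 = 1) (n : ℕ) :
    ratTaylorCoeff (P * U) (Q * U) n = ratTaylorCoeff P Q n := by
  have hQU : (Q * U).coeff 0 = 1 := by rw [Polynomial.mul_coeff_zero, hQ, hU, one_mul]
  symm
  refine ratTaylorCoeff_unique (P * U) (Q * U) hQU (fun m => ?_) n
  -- `Q · C = P` as power series, from the defining identity of `ratTaylorCoeff P Q`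
  have hC : (Q : PowerSeries 𝕜) * PowerSeries.mk (ratTaylorCoeff P Q) = (P : PowerSeries 𝕜) := by
    ext k
    rw [coeff_coe_mul_mk, sum_ratTaylorCoeff_eq_coeff P Q hQ k, Polynomial.coeff_coe]
  -- hence `(Q U) · C = P U`
  have hCU : ((Q * U : 𝕜[X]) : PowerSeries 𝕜) * PowerSeries.mk (ratTaylorCoeff P Q) = ((P * U : 𝕜[X]) : PowerSeries 𝕜) := by
    rw [Polynomial.coe_mul, Polynomial.coe_mul, mul_right_comm, hC]
  have h := congrArg (PowerSeries.coeff m) hCU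
  rwa [coeff_coe_mul_mk, Polynomial.coeff_coe] at h

/-- **MAJORANT THROUGH A PRECONDITIONER**, degree-bound form: with `U₀ = 1`, `deg (Q·U) ≤ D_Q`, `deg (P·U) ≤ D_P`,
`ρ > 0`, `Σ_{j<D_Q} ‖(QU)_{j+1}‖ ρ^{j+1} ≤ θ < 1` and `Σ_{i≤D_P} ‖(PU)_i‖ ρⁱ ≤ S`, the Taylor coefficients of `P/Q`
satisfy `‖cₙ‖ ≤ (S/(1 − θ)) ρ⁻ⁿ`. [cite: Henrici1974, §1.2 Thm 1.2b; §2.3 Lemma 2.3f] -/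
theorem norm_ratTaylorCoeff_le_precond (hQ : Q.coeff 0 = 1) {U : 𝕜[X]} (hU : U.coeff 0 = 1) {ρ θ S : ℝ}
    (hρ : 0 < ρ) {DQ DP : ℕ} (hDQ : (Q * U).natDegree ≤ DQ) (hDP : (P * U).natDegree ≤ DP)
    (hθ : ∑ j ∈ range DQ, ‖(Q * U).coeff (j + 1)‖ * ρ ^ (j + 1) ≤ θ) (hθ1 : θ < 1)
    (hS : ∑ i ∈ range (DP + 1), ‖(P * U).coeff i‖ * ρ ^ i ≤ S) (n : ℕ) :
    ‖ratTaylorCoeff P Q n‖ ≤ S / (1 - θ) * ρ⁻¹ ^ n := by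
  rw [← ratTaylorCoeff_mul_right P Q hQ hU n]
  exact norm_ratTaylorCoeff_le (P * U) (Q * U) hρ (denMargin_of_natDegree_le (Q * U) hDQ hρ.le hθ) hθ1
    (numSum_of_natDegree_le (P * U) hDP hρ.le hS) n

end Precondition

end Literature.Analysis.ODE

end
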